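import Summits.ResolutionOfSingularities.ResolutionOfSingularities.Theorems.ConeExit.Negative.Mirror
import HarnessLib

/-!
# `WildCones.ConeExit` (stmt-ResolutionOfSingularities-16883), line `critical-plane`:
# stub `stub_faceDictionary`

THE CHART DICTIONARY of the one-step cone exit lemma. `step p i τ c` is the successor state
(chart `uᵢ`, translation `τ`) of the point-blow-up dynamics of `zᵖ = a(u)`:
`step = clean ∘ translate ∘ divide-by-uᵢ^s ∘ blow-up-chart-i ∘ clean` with `s = p` as soon as the
cleaned state has order `≥ p`. The stub says: under multiplicity `p` of `c` (the cleaned `c` is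
non-zero and all its non-zero coefficients sit in total degree `≥ p`), the coefficient of the
successor at an exponent `B` on the FACE `{Bᵢ = 0}` is `0` if `B` is all-`p`-divisible (cleaning)
and otherwise equals the coefficient of `X^B` in
`P := aeval σ (cone p c)`, `σ j = if j = i then 1 else C (τ j) + X j`,
i.e. in the dehomogenised (`uᵢ = 1`), translated tangent cone `a_p(w + v̂)`.

Proof (pure bookkeeping, no primality and no characteristic hypothesis):
* `faceDict_ord_ge`: the multiplicity hypothesis gives `p ≤ ord (clean p c)`, so `step` divides by
  `uᵢ ^ p`;
* `faceDict_tr_dv_bl`: unfolding `tr ∘ dv ∘ bl` at an exponent `B` with `B i = 0` gives an explicit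
  sum over the translation multi-index `D`;
* `faceDict_coeff_prod_binomial`: the coefficient of `X^B` in `∏ j (X j + C (t j)) ^ (A j)` is
  `∏ j choose (A j) (B j) * t j ^ (A j - B j)` (multi-binomial theorem);
* `faceDict_coeff_aeval_cone`: hence `coeff B P` is an explicit sum over the exponents `A` of the
  cone;
* `faceDict_reindex`: the two sums agree under the bijection
  `D ↦ A_D := update (B + D) i (p - |B + D|')` (`|·|'` = sum over `j ≠ i`), with inverse
  `A ↦ (j ↦ if j = i then 0 else A j - B j)`.
-/

noncomputable section

-- single-problem summit: the doubled namespace component `ResolutionOfSingularities` is forced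
set_option linter.dupNamespace false

open Summit.ResolutionOfSingularities.ResolutionOfSingularities.Theorems.ConeExit.Negative
  (clean bl ord dv tr step ser pd jac cone Linv dL)
open scoped BigOperators

namespace Summit.ResolutionOfSingularities.ResolutionOfSingularities.Theorems.WildConesConeExit

open MvPolynomial Finset Function

variable {n : ℕ} {κ : Type} [Field κ]

/-- Under the multiplicity hypothesis the cleaned state has order at least `p`. [folklore] -/
theorem faceDict_ord_ge (p : ℕ) (c : (Fin n → ℕ) → κ)
    (hM : (∃ A, clean p c A ≠ 0) ∧
      ∀ A, clean p c A ≠ 0 → p ≤ Finset.sum Finset.univ (fun j => A j)) :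
    p ≤ ord (clean p c) := by
  obtain ⟨⟨A₀, hA₀⟩, hmin⟩ := hM
  unfold ord
  refine le_csInf ⟨_, A₀, hA₀, rfl⟩ ?_
  rintro m ⟨A, hA, rfl⟩
  exact hmin A hA

/-- The value of a cleaned coefficient function: zero on the all-`p`-divisible exponents.
[folklore] -/
theorem faceDict_clean_of_dvd (p : ℕ) (c : (Fin n → ℕ) → κ) (A : Fin n → ℕ)
    (h : ∀ j, p ∣ A j) : clean p c A = 0 := by
  simp only [clean]
  rw [if_pos h]

/-- The value of a cleaned coefficient function: unchanged off the all-`p`-divisible exponents.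
[folklore] -/
theorem faceDict_clean_of_not_dvd (p : ℕ) (c : (Fin n → ℕ) → κ) (A : Fin n → ℕ)
    (h : ¬ ∀ j, p ∣ A j) : clean p c A = c A := by
  simp only [clean]
  rw [if_neg h]

/-- **Multi-binomial theorem, coefficient form.** The coefficient of `X^B` in
`∏ j, (X j + C (t j)) ^ (A j)` is `∏ j, choose (A j) (B j) * t j ^ (A j - B j)` (the factor
`choose (A j) (B j)` vanishes as soon as `B j > A j`). [folklore] -/
theorem faceDict_coeff_prod_binomial (A : Fin n → ℕ) (t : Fin n → κ) (B : Fin n →₀ ℕ) :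
    MvPolynomial.coeff B (∏ j, (X j + C (t j)) ^ (A j) : MvPolynomial (Fin n) κ) =
      ∏ j, (((Nat.choose (A j) (B j) : ℕ) : κ) * t j ^ (A j - B j)) := by
  have expand : ∀ j : Fin n, ((X j + C (t j)) ^ (A j) : MvPolynomial (Fin n) κ) =
      ∑ k ∈ Finset.range (A j + 1),
        X j ^ k * C (t j) ^ (A j - k) * ((Nat.choose (A j) k : ℕ) : MvPolynomial (Fin n) κ) :=
    fun j => add_pow _ _ _
  have hterm : ∀ K : Fin n → ℕ,
      (∏ j, X j ^ (K j) * C (t j) ^ (A j - K j) *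
          ((Nat.choose (A j) (K j) : ℕ) : MvPolynomial (Fin n) κ)) =
        monomial (Finsupp.equivFunOnFinite.symm K)
          (∏ j, (((Nat.choose (A j) (K j) : ℕ) : κ) * t j ^ (A j - K j))) := by
    intro K
    rw [monomial_eq, Finsupp.prod_fintype _ _ (fun j => pow_zero _), map_prod,
      ← Finset.prod_mul_distrib]
    refine Finset.prod_congr rfl (fun j _ => ?_)
    simp only [Finsupp.coe_equivFunOnFinite_symm, map_mul, map_pow, map_natCast]
    ring
  simp_rw [expand]
  rw [Finset.prod_univ_sum]
  simp_rw [hterm]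
  rw [coeff_sum, Finset.sum_eq_single (⇑B)]
  · simp only [Finsupp.equivFunOnFinite_symm_coe, coeff_monomial, if_true]
  · intro K _ hK
    classical
    rw [coeff_monomial, if_neg]
    intro h
    apply hK
    rw [← h, Finsupp.coe_equivFunOnFinite_symm]
  · intro hB
    rw [Fintype.mem_piFinset] at hB
    push Not at hB
    obtain ⟨j, hj⟩ := hB
    rw [Finset.mem_range, not_lt] at hj
    classical
    rw [coeff_monomial, if_pos (Finsupp.equivFunOnFinite_symm_coe B)]
    apply Finset.prod_eq_zero (Finset.mem_univ j)
    rw [Nat.choose_eq_zero_of_lt (by omega), Nat.cast_zero, zero_mul]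

/-- Unfolding `tr ∘ dv ∘ bl` (translation after division by `uᵢ ^ p` after the blow-up chart `uᵢ`)
at an exponent `B` on the face `B i = 0`: an explicit sum over the translation multi-index `D`.
[folklore] -/
theorem faceDict_tr_dv_bl (p : ℕ) (G : (Fin n → ℕ) → κ) (i : Fin n) (τ : Fin n → κ)
    (B : Fin n → ℕ) (hB : B i = 0) :
    tr i τ p (dv i p (bl i G)) B =
      ∑ D ∈ Fintype.piFinset (fun _ : Fin n => Finset.range (p + 1)),
        if D i = 0 ∧ ∑ j ∈ univ.erase i, (B j + D j) ≤ p then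
          G (update (B + D) i (p - ∑ j ∈ univ.erase i, (B j + D j))) *
            ∏ j ∈ univ.erase i, (((Nat.choose (B j + D j) (B j) : ℕ) : κ) * τ j ^ (D j))
        else 0 := by
  simp only [tr, dv, bl]
  rw [hB, zero_add]
  refine Finset.sum_congr rfl (fun D _ => ?_)
  by_cases hDi : D i = 0
  · have hE : ∀ j ∈ univ.erase i, update (B + D) i ((B + D) i + p) j = B j + D j := fun j hj => by
      rw [update_of_ne (ne_of_mem_erase hj), Pi.add_apply]
    have hEi : update (B + D) i ((B + D) i + p) i = p := by
      rw [update_self, Pi.add_apply, hB, hDi, zero_add, zero_add]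
    rw [if_pos hDi, Finset.sum_congr rfl hE, hEi, update_idem]
    by_cases hS : ∑ j ∈ univ.erase i, (B j + D j) ≤ p
    · rw [if_pos hS, if_pos ⟨hDi, hS⟩]
    · rw [if_neg hS, if_neg (fun h => hS h.2), zero_mul]
  · rw [if_neg hDi, if_neg (fun h => hDi h.1)]

/-- The coefficient of `X^B` (`B i = 0`) in the dehomogenised translated cone
`aeval (j ↦ if j = i then 1 else C (τ j) + X j) (cone p c)`, as an explicit sum over the exponents
`A` of the cone. [folklore] -/
theorem faceDict_coeff_aeval_cone (p : ℕ) (c : (Fin n → ℕ) → κ) (i : Fin n) (τ : Fin n → κ)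
    (B : Fin n → ℕ) (hB : B i = 0) :
    MvPolynomial.coeff (Finsupp.equivFunOnFinite.symm B)
        (MvPolynomial.aeval (fun j : Fin n => if j = i then (1 : MvPolynomial (Fin n) κ)
          else MvPolynomial.C (τ j) + MvPolynomial.X j) (cone p c)) =
      ∑ A ∈ Fintype.piFinset (fun _ : Fin n => Finset.range (p + 1)),
        if ∑ j, A j = p then
          clean p c A * ∏ j ∈ univ.erase i, (((Nat.choose (A j) (B j) : ℕ) : κ) * τ j ^ (A j - B j))
        else 0 := by
  simp only [cone]
  rw [map_sum, coeff_sum]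
  refine Finset.sum_congr rfl (fun A _ => ?_)
  by_cases hA : ∑ j, A j = p
  · rw [if_pos hA, if_pos hA, aeval_monomial, algebraMap_eq, coeff_C_mul,
      Finsupp.prod_fintype _ _ (fun j => pow_zero _)]
    congr 1
    have hσ : (∏ j, (fun j : Fin n => if j = i then (1 : MvPolynomial (Fin n) κ)
          else MvPolynomial.C (τ j) + MvPolynomial.X j) j ^ (Finsupp.equivFunOnFinite.symm A) j) =
        ∏ j, (X j + C (τ j)) ^ ((fun j => if j = i then 0 else A j) j) := by
      refine Finset.prod_congr rfl (fun j _ => ?_)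
      simp only [Finsupp.coe_equivFunOnFinite_symm]
      by_cases hji : j = i
      · rw [if_pos hji, if_pos hji, one_pow, pow_zero]
      · rw [if_neg hji, if_neg hji, add_comm]
    rw [hσ, faceDict_coeff_prod_binomial, ← Finset.mul_prod_erase _ _ (Finset.mem_univ i)]
    simp only [Finsupp.coe_equivFunOnFinite_symm, if_true, hB, Nat.choose_zero_right,
      Nat.cast_one, Nat.sub_zero, pow_zero, mul_one, one_mul]
    refine Finset.prod_congr rfl (fun j hj => ?_)
    rw [if_neg (ne_of_mem_erase hj)]
  · rw [if_neg hA, if_neg hA, map_zero, coeff_zero]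

/-- **Reindexing.** The explicit `D`-sum of `faceDict_tr_dv_bl` equals the explicit `A`-sum of
`faceDict_coeff_aeval_cone`, via the bijection `D ↦ update (B + D) i (p - ∑_{j ≠ i} (B j + D j))`
with inverse `A ↦ (j ↦ if j = i then 0 else A j - B j)`. [folklore] -/
theorem faceDict_reindex (p : ℕ) (G : (Fin n → ℕ) → κ) (i : Fin n) (τ : Fin n → κ)
    (B : Fin n → ℕ) :
    (∑ D ∈ Fintype.piFinset (fun _ : Fin n => Finset.range (p + 1)),
        if D i = 0 ∧ ∑ j ∈ univ.erase i, (B j + D j) ≤ p then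
          G (update (B + D) i (p - ∑ j ∈ univ.erase i, (B j + D j))) *
            ∏ j ∈ univ.erase i, (((Nat.choose (B j + D j) (B j) : ℕ) : κ) * τ j ^ (D j))
        else 0) =
      ∑ A ∈ Fintype.piFinset (fun _ : Fin n => Finset.range (p + 1)),
        if ∑ j, A j = p then
          G A * ∏ j ∈ univ.erase i, (((Nat.choose (A j) (B j) : ℕ) : κ) * τ j ^ (A j - B j))
        else 0 := by
  -- strengthen the condition on the right: the summand vanishes unless `B j ≤ A j` off `i`
  have hR : ∀ A ∈ Fintype.piFinset (fun _ : Fin n => Finset.range (p + 1)),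
      (if ∑ j, A j = p then
          G A * ∏ j ∈ univ.erase i, (((Nat.choose (A j) (B j) : ℕ) : κ) * τ j ^ (A j - B j))
        else 0) =
      if ∑ j, A j = p ∧ ∀ j ∈ univ.erase i, B j ≤ A j then
          G A * ∏ j ∈ univ.erase i, (((Nat.choose (A j) (B j) : ℕ) : κ) * τ j ^ (A j - B j))
        else 0 := by
    intro A _
    by_cases h1 : ∑ j, A j = p
    · by_cases h2 : ∀ j ∈ univ.erase i, B j ≤ A j
      · rw [if_pos h1, if_pos ⟨h1, h2⟩]
      · rw [if_pos h1, if_neg (fun h => h2 h.2)]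
        push Not at h2
        obtain ⟨j, hj, hlt⟩ := h2
        refine mul_eq_zero_of_right _ (Finset.prod_eq_zero hj ?_)
        rw [Nat.choose_eq_zero_of_lt hlt, Nat.cast_zero, zero_mul]
    · rw [if_neg h1, if_neg (fun h => h1 h.1)]
  rw [Finset.sum_congr rfl hR, ← Finset.sum_filter, ← Finset.sum_filter]
  -- two bookkeeping identities for the inverse map
  have hS : ∀ A : Fin n → ℕ, (∀ j ∈ univ.erase i, B j ≤ A j) →
      ∑ k ∈ univ.erase i, (B k + (if k = i then 0 else A k - B k)) = ∑ k ∈ univ.erase i, A k :=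
    fun A hBA => Finset.sum_congr rfl (fun k hk => by
      rw [if_neg (ne_of_mem_erase hk)]
      have := hBA k hk
      omega)
  have hAi : ∀ A : Fin n → ℕ, ∑ j, A j = p → A i + ∑ k ∈ univ.erase i, A k = p := fun A hsum => by
    rw [Finset.add_sum_erase _ _ (Finset.mem_univ i)]
    exact hsum
  refine Finset.sum_nbij'
    (fun D => update (B + D) i (p - ∑ j ∈ univ.erase i, (B j + D j)))
    (fun A j => if j = i then 0 else A j - B j) ?_ ?_ ?_ ?_ ?_
  · -- maps into
    intro D hD
    simp only [Finset.mem_filter, Fintype.mem_piFinset, Finset.mem_range] at hD ⊢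
    obtain ⟨-, hDi, hSp⟩ := hD
    refine ⟨fun j => ?_, ?_, fun j hj => ?_⟩
    · rcases eq_or_ne j i with rfl | hji
      · rw [update_self]
        omega
      · rw [update_of_ne hji, Pi.add_apply]
        have := Finset.single_le_sum (f := fun j => B j + D j) (fun _ _ => Nat.zero_le _)
          (Finset.mem_erase.mpr ⟨hji, Finset.mem_univ j⟩)
        omega
    · rw [← Finset.add_sum_erase _ _ (Finset.mem_univ i), update_self,
        Finset.sum_congr rfl (fun j hj => update_of_ne (ne_of_mem_erase hj) _ (B + D))]
      simp only [Pi.add_apply]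
      omega
    · rw [update_of_ne (ne_of_mem_erase hj), Pi.add_apply]
      omega
  · -- the inverse maps into
    intro A hA
    simp only [Finset.mem_filter, Fintype.mem_piFinset, Finset.mem_range] at hA ⊢
    obtain ⟨hAp, hsum, hBA⟩ := hA
    refine ⟨fun j => ?_, if_pos trivial, ?_⟩
    · have := hAp j
      split_ifs <;> omega
    · show ∑ k ∈ univ.erase i, (B k + (if k = i then 0 else A k - B k)) ≤ p
      rw [hS A hBA]
      have := hAi A hsum
      omega
  · -- left inverse
    intro D hD
    simp only [Finset.mem_filter, Fintype.mem_piFinset, Finset.mem_range] at hD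
    obtain ⟨-, hDi, -⟩ := hD
    funext j
    by_cases hji : j = i
    · rw [if_pos hji, hji, hDi]
    · rw [if_neg hji, update_of_ne hji, Pi.add_apply]
      omega
  · -- right inverse
    intro A hA
    simp only [Finset.mem_filter, Fintype.mem_piFinset, Finset.mem_range] at hA
    obtain ⟨-, hsum, hBA⟩ := hA
    funext j
    by_cases hji : j = i
    · rw [hji, update_self]
      show p - ∑ k ∈ univ.erase i, (B k + (if k = i then 0 else A k - B k)) = A i
      rw [hS A hBA]
      have := hAi A hsum
      omega
    · rw [update_of_ne hji]
      show B j + (if j = i then 0 else A j - B j) = A j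
      rw [if_neg hji]
      have := hBA j (Finset.mem_erase.mpr ⟨hji, Finset.mem_univ j⟩)
      omega
  · -- the summands agree
    intro D _
    congr 1
    refine Finset.prod_congr rfl (fun j hj => ?_)
    rw [update_of_ne (ne_of_mem_erase hj), Pi.add_apply, Nat.add_sub_cancel_left]

/-- **STUB `stub_faceDictionary` (THE CHART DICTIONARY).** Under multiplicity `p` of `c`, the
coefficient of the successor `step p i τ c` at an exponent `B` on the face `Bᵢ = 0` is the
(cleaned) coefficient of `X^B` in the dehomogenised translated cone
`a_p(w + v̂) = aeval (j ↦ if j = i then 1 else C (τ j) + X j) (cone p c)`. [folklore] -/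
theorem stub_faceDictionary : ∀ (p n : ℕ) (κ : Type) [Field κ] (c : (Fin n → ℕ) → κ) (i : Fin n) (τ : Fin n → κ) (B : Fin n → ℕ), ((∃ A, clean p c A ≠ 0) ∧ ∀ A, clean p c A ≠ 0 → p ≤ Finset.sum Finset.univ (fun j => A j)) → B i = 0 → step p i τ c B = if (∀ j, p ∣ B j) then 0 else MvPolynomial.coeff (Finsupp.equivFunOnFinite.symm B) (MvPolynomial.aeval (fun j : Fin n => if j = i then (1 : MvPolynomial (Fin n) κ) else MvPolynomial.C (τ j) + MvPolynomial.X j) (cone p c)) := by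
  intro p n κ _ c i τ B hM hB
  have hord : p ≤ ord (clean p c) := faceDict_ord_ge p c hM
  have hstep : step p i τ c B = clean p (tr i τ p (dv i p (bl i (clean p c)))) B := by
    simp only [step]
    rw [if_pos hord]
  rw [hstep]
  by_cases hdiv : ∀ j, p ∣ B j
  · rw [if_pos hdiv, faceDict_clean_of_dvd p _ B hdiv]
  · rw [if_neg hdiv, faceDict_clean_of_not_dvd p _ B hdiv,
      faceDict_tr_dv_bl p (clean p c) i τ B hB, faceDict_coeff_aeval_cone p c i τ B hB]
    exact faceDict_reindex p (clean p c) i τ B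

end Summit.ResolutionOfSingularities.ResolutionOfSingularities.Theorems.WildConesConeExit

end
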